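import Literature.NumberTheory.GaloisRepresentations.PowerSeriesTopNilpotentModule
import HarnessLib

/-!
# Intertwining operators between two `S⟦T⟧`-actions `T ↦ D`, `T ↦ D′` on `S⟦Y⟧`, the WEIGHT MODULES `T ↦ a` (`a ∈ (p)`), the
# `(p)`-adic evaluation `tEval : S⟦T⟧ →+* S`, `T ↦ a`, and the SPECIALISATION of functionals: `λ(c • r) = c(a) · λ(r)`

De Shalit, *Iwasawa theory of elliptic curves with complex multiplication* (1987), Ch. I §3.1 (`Λ ≅ ℤ_p⟦S⟧`, `u^α ↦ (1+S)^α`), §3.5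
(i)–(ii) ("`φ_k(γ(β)) = κ(γ)^k φ_k(β)`": the Coates–Wiles homomorphisms are `Λ`-module maps onto `𝒪(κ^k)`); Washington, *Introduction to
Cyclotomic Fields* (1997), §13.2 (a `Λ`-homomorphism into `ℤ_p(χ)` is evaluation of power series at `T = χ(γ) − 1`).  The prequels
`PowerSeriesTopNilpotentAction` / `PowerSeriesTopNilpotentModule` built the `S⟦T⟧`-module `TActModule D hD` (`= S⟦Y⟧`, `c • r = Σ_k c_k D^k r`)
for an `S`-linear `D` with `D(I_N) ⊆ I_{N+1}` (`I_N = adicFiltGen p N` the coefficientwise `(p, Y)`-adic filtration) and proved that an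
operator COMMUTING with `D` and preserving the filtration is `S⟦T⟧`-linear (`TActModule.linearOfCommute`).  THIS file is the HETERO version
and its first application (everything PROVED, 0 sorry, no named facts):

* §1 ★ `tAct_intertwine` / **`TActModule.linearOfIntertwine`** — an `S`-linear `L : S⟦Y⟧ → S⟦Y⟧` with **`L ∘ D = D′ ∘ L`** and a continuity
  LAG `m` (`L(I_{N+m}) ⊆ I_N`) satisfies `L(c(T)·_D r) = c(T)·_{D′} (L r)`: it is an `S⟦T⟧`-LINEAR map `TActModule D hD → TActModule D′ hD′`;
* §2 the WEIGHT OPERATOR `weightOp a = (C a)·` for `a ∈ (p)` (`weightOp_adic`: `(C a)·I_N ⊆ I_{N+1}`), so that `TActModule (weightOp a) _` is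
  `S⟦Y⟧` with `T` acting as the constant `a` — the module `S⟦Y⟧(a)`; ★ **`tEval ha : S⟦T⟧ →+* S`**, `c ↦ c(a) := Σ_k c_k a^k` (the `(p)`-adic
  limit, read off `c • 1`): `tEval_sub_sum_mem` (`c(a) ≡ Σ_{k<K} c_k a^k (mod p^K)`), `eq_tEval_of_forall_sub_mem` (characterisation),
  `tEval_C`, ★ `tEval_X` (`T ↦ a`), `tEval_one_add_X_pow` (`(1+T)^n ↦ (1+a)^n`), ★ `tAct_weightOp` (**`c • r = c(a)·r`** in the weight module);
* §3 ★★ **`apply_tAct_eq_tEval_mul`** — an `S`-linear FUNCTIONAL `λ : S⟦Y⟧ → S` with **`λ(D r) = a·λ(r)`** and `λ(I_{N+m}) ⊆ (p^N)` satisfies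
  **`λ(c • r) = c(a) · λ(r)` for EVERY `c ∈ S⟦T⟧`** (`TActModule.apply_smul_eq_tEval_mul`); hence `λ((T − a) • r) = 0`
  (`TActModule.apply_X_sub_C_smul`) and `λ((1+T)^n • r) = (1+a)^n λ(r)`: `λ` is the SPECIALISATION of `TActModule D hD` at `T = a`
  (`TActModule.functionalₗ`: the `S⟦T⟧`-linear map into the weight module).  The sequel `LubinTateColemanCoordMomentsLinearTwo` instantiates
  `λ = mom_k` (the `k`-th moment / Coates–Wiles functional of the Coleman coordinate module at `q = 2`, `a = γ^{k+1} − 1`).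

Definitions (transparent): `weightOp`, `tEval`, `TActModule.linearOfIntertwine`, `TActModule.functionalₗ`.

## References

* E. de Shalit, *Iwasawa theory of elliptic curves with complex multiplication* (1987), Ch. I §3.1, §3.5 (i)–(ii), §3.7. [deShalit1987]
* L. C. Washington, *Introduction to Cyclotomic Fields*, 2nd ed. (1997), §7.1, §13.2. [Washington1997]
-/

noncomputable section

namespace Literature.NumberTheory.GaloisRepresentations

namespace LubinTate

open Finset

variable {S : Type*} [CommRing S] {p : S}

/-! ### §1. Operators intertwining two actions -/

section Intertwine

variable {D D' : PowerSeries S →ₗ[S] PowerSeries S}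
  (hD : ∀ N (r : PowerSeries S), r ∈ adicFiltGen p N → D r ∈ adicFiltGen p (N + 1))
  (hD' : ∀ N (r : PowerSeries S), r ∈ adicFiltGen p N → D' r ∈ adicFiltGen p (N + 1))
  {L : PowerSeries S →ₗ[S] PowerSeries S} (hLD : ∀ r, L (D r) = D' (L r))
  {m : ℕ} (hL : ∀ N (r : PowerSeries S), r ∈ adicFiltGen p (N + m) → L r ∈ adicFiltGen p N)

include hLD in
/-- `L ∘ D = D′ ∘ L` gives `L ∘ D^k = D′^k ∘ L`. [cite: Washington1997, §13.2] -/
theorem iterate_intertwine (k : ℕ) (r : PowerSeries S) : (⇑D')^[k] (L r) = L ((⇑D)^[k] r) := by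
  induction k generalizing r with
  | zero => rfl
  | succ k ih => rw [Function.iterate_succ_apply, Function.iterate_succ_apply, ← hLD, ih]

include hLD in
/-- An intertwining `L` intertwines the partial sums: `Σ_{k<K} c_k D′^k (L r) = L (Σ_{k<K} c_k D^k r)`. [cite: Washington1997, §13.2] -/
theorem tPartial_intertwine (c r : PowerSeries S) (K : ℕ) : tPartial D' c (L r) K = L (tPartial D c r K) := by
  rw [tPartial_def, tPartial_def, map_sum]
  refine sum_congr rfl fun k _ => ?_
  rw [iterate_intertwine hLD, ← PowerSeries.smul_eq_C_mul, ← PowerSeries.smul_eq_C_mul, map_smul]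

include hD in
/-- A tail of the partial sums lies deep in the filtration: `Σ_{K ≤ k < K+n} c_k D^k r ∈ I_K`. [cite: Washington1997, §13.2] -/
theorem tPartial_add_sub_tPartial_mem (c r : PowerSeries S) (K n : ℕ) :
    tPartial D c r (K + n) - tPartial D c r K ∈ adicFiltGen p K := by
  rw [tPartial_def, tPartial_def, ← sum_range_add_sum_Ico _ (Nat.le_add_right K n), add_sub_cancel_left]
  refine Ideal.sum_mem _ fun k hk => ?_
  have hk' := (mem_Ico.mp hk).1
  have h := mul_mem_adicFiltGen (mem_adicFiltGen_zero (p := p) (PowerSeries.C (PowerSeries.coeff k c)))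
    (iterate_mem_adicFiltGen hD k (mem_adicFiltGen_zero (p := p) r))
  rw [Nat.zero_add, Nat.zero_add] at h
  exact adicFiltGen_mono hk' h

include hD hLD hL in
/-- ★ **An `S`-linear `L` with `L ∘ D = D′ ∘ L` and `L(I_{N+m}) ⊆ I_N` intertwines the two `S⟦T⟧`-actions: `c(T)·_{D′}(L r) = L(c(T)·_D r)`.**
[cite: deShalit1987, Ch. I §3.4 Lemma (ii), §3.7] [cite: Washington1997, §13.2] -/
theorem tAct_intertwine [IsAdicComplete (Ideal.span {p}) S] (c r : PowerSeries S) :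
    tAct D' hD' c (L r) = L (tAct D hD c r) := by
  symm
  refine eq_tAct_of_forall_sub_mem hD' fun K => ?_
  have e : L (tAct D hD c r) - tPartial D' c (L r) K =
      L (tAct D hD c r - tPartial D c r (K + m)) + (tPartial D' c (L r) (K + m) - tPartial D' c (L r) K) := by
    rw [map_sub, ← tPartial_intertwine hLD]; abel
  rw [e]
  exact add_mem (hL K _ (tAct_sub_tPartial_mem hD c r (K + m))) (tPartial_add_sub_tPartial_mem hD' c (L r) K m)

end Intertwine

namespace TActModule

section LinearOfIntertwine

variable [IsAdicComplete (Ideal.span {p}) S]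
  (D : PowerSeries S →ₗ[S] PowerSeries S) (hD : ∀ N (r : PowerSeries S), r ∈ adicFiltGen p N → D r ∈ adicFiltGen p (N + 1))
  (D' : PowerSeries S →ₗ[S] PowerSeries S) (hD' : ∀ N (r : PowerSeries S), r ∈ adicFiltGen p N → D' r ∈ adicFiltGen p (N + 1))

/-- ★ **`TActModule.linearOfIntertwine`**: an `S`-linear `L` with `L ∘ D = D′ ∘ L` and `L(I_{N+m}) ⊆ I_N`, as an `S⟦T⟧`-LINEAR map
`TActModule D hD → TActModule D′ hD′`. [cite: deShalit1987, Ch. I §3.5 (ii), §3.7] [cite: Washington1997, §13.2] -/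
def linearOfIntertwine (L : PowerSeries S →ₗ[S] PowerSeries S) (hLD : ∀ r, L (D r) = D' (L r))
    (m : ℕ) (hL : ∀ N (r : PowerSeries S), r ∈ adicFiltGen p (N + m) → L r ∈ adicFiltGen p N) :
    TActModule D hD →ₗ[PowerSeries S] TActModule D' hD' where
  toFun r := ofPS D' hD' (L (toPS r))
  map_add' r r' := by
    change ofPS D' hD' (L (toPS r + toPS r')) = _
    rw [map_add]; rfl
  map_smul' c r := by
    change ofPS D' hD' (L (tAct D hD c (toPS r))) = ofPS D' hD' (tAct D' hD' c (L (toPS r)))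
    rw [tAct_intertwine hD hD' hLD hL]

/-- Unfolding `linearOfIntertwine`. [cite: deShalit1987, Ch. I §3.7] -/
@[simp] theorem toPS_linearOfIntertwine_apply (L : PowerSeries S →ₗ[S] PowerSeries S)
    (hLD : ∀ r, L (D r) = D' (L r)) (m : ℕ) (hL : ∀ N (r : PowerSeries S), r ∈ adicFiltGen p (N + m) → L r ∈ adicFiltGen p N)
    (r : TActModule D hD) : toPS (linearOfIntertwine D hD D' hD' L hLD m hL r) = L (toPS r) := rfl

/-- `linearOfIntertwine L (ofPS r) = ofPS (L r)`. [cite: deShalit1987, Ch. I §3.7] -/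
theorem linearOfIntertwine_ofPS (L : PowerSeries S →ₗ[S] PowerSeries S)
    (hLD : ∀ r, L (D r) = D' (L r)) (m : ℕ) (hL : ∀ N (r : PowerSeries S), r ∈ adicFiltGen p (N + m) → L r ∈ adicFiltGen p N)
    (r : PowerSeries S) : linearOfIntertwine D hD D' hD' L hLD m hL (ofPS D hD r) = ofPS D' hD' (L r) := rfl

end LinearOfIntertwine

end TActModule

/-! ### §2. The weight modules `T ↦ a` and the evaluation `tEval : S⟦T⟧ →+* S` -/

section Weight

/-- **`weightOp a = (C a)·`** — multiplication by the constant `a`, the operator through which `T` acts on the WEIGHT MODULE `S⟦Y⟧(a)`.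
[cite: Washington1997, §13.2] -/
def weightOp (a : S) : PowerSeries S →ₗ[S] PowerSeries S := LinearMap.mulLeft S (PowerSeries.C a)

/-- Unfolding: `weightOp a r = C a * r`. [cite: Washington1997, §13.2] -/
theorem weightOp_apply (a : S) (r : PowerSeries S) : weightOp a r = PowerSeries.C a * r := rfl

/-- For `a ∈ (p)` the weight operator raises the filtration: `(C a)·I_N ⊆ I_{N+1}`. [cite: Washington1997, §13.2] -/
theorem weightOp_adic {a : S} (ha : a ∈ Ideal.span {p}) (N : ℕ) (r : PowerSeries S) (hr : r ∈ adicFiltGen p N) :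
    weightOp a r ∈ adicFiltGen p (N + 1) := by
  rw [weightOp_apply, Nat.add_comm]
  exact mul_mem_adicFiltGen (C_mem_adicFiltGen (by rwa [pow_one])) hr

/-- `(weightOp a)^k r = C (a^k) * r`. [cite: Washington1997, §13.2] -/
theorem iterate_weightOp (a : S) (k : ℕ) (r : PowerSeries S) : (⇑(weightOp a))^[k] r = PowerSeries.C (a ^ k) * r := by
  induction k with
  | zero => rw [Function.iterate_zero_apply, pow_zero, map_one, one_mul]
  | succ k ih => rw [Function.iterate_succ_apply', ih, weightOp_apply, ← mul_assoc, ← map_mul, ← pow_succ']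

/-- The partial sums in the weight module: `Σ_{k<K} c_k (C a)^k r = C(Σ_{k<K} c_k a^k) * r`. [cite: Washington1997, §13.2] -/
theorem tPartial_weightOp (a : S) (c r : PowerSeries S) (K : ℕ) :
    tPartial (weightOp a) c r K = PowerSeries.C (∑ k ∈ range K, PowerSeries.coeff k c * a ^ k) * r := by
  rw [tPartial_def, map_sum, sum_mul]
  exact sum_congr rfl fun k _ => by rw [iterate_weightOp, ← mul_assoc, ← map_mul]

variable [IsAdicComplete (Ideal.span {p}) S] {a : S} (ha : a ∈ Ideal.span {p})

/-- ★ **`tEval ha c = c(a) := Σ_k c_k a^k`** — the `(p)`-adic evaluation of `c ∈ S⟦T⟧` at `T = a ∈ (p)` (read off the action on `1` in the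
weight module: the constant term of `c • 1`). [cite: Washington1997, §7.1, §13.2] -/
def tEval (c : PowerSeries S) : S := PowerSeries.constantCoeff (tAct (weightOp a) (weightOp_adic ha) c 1)

/-- ★ **`c(a) ≡ Σ_{k<K} c_k a^k (mod p^K)`** for every `K`. [cite: Washington1997, §7.1] -/
theorem tEval_sub_sum_mem (c : PowerSeries S) (K : ℕ) :
    tEval ha c - ∑ k ∈ range K, PowerSeries.coeff k c * a ^ k ∈ Ideal.span {p ^ K} := by
  have h := tAct_sub_tPartial_mem (weightOp_adic ha) c 1 K 0
  rw [tPartial_weightOp, mul_one, map_sub, PowerSeries.coeff_zero_eq_constantCoeff, PowerSeries.constantCoeff_C, Nat.sub_zero] at h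
  exact h

/-- **Characterisation**: an `x ∈ S` congruent to the partial sums `Σ_{k<K} c_k a^k` modulo `p^K` for all `K` is `c(a)` (`S` is
`(p)`-adically Hausdorff). [cite: Washington1997, §7.1] -/
theorem eq_tEval_of_forall_sub_mem {c : PowerSeries S} {x : S} (hx : ∀ K, x - ∑ k ∈ range K, PowerSeries.coeff k c * a ^ k ∈ Ideal.span {p ^ K}) :
    x = tEval ha c := by
  refine sub_eq_zero.mp (IsHausdorff.haus' (I := Ideal.span {p}) _ fun K => ?_)
  rw [SModEq.sub_mem, sub_zero, smul_eq_mul, Ideal.mul_top, Ideal.span_singleton_pow]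
  have h := sub_mem (hx K) (tEval_sub_sum_mem ha c K)
  rwa [sub_sub_sub_cancel_right] at h

/-- ★ **In the weight module the action is multiplication by the value: `c(T)·r = C(c(a)) * r`.** [cite: Washington1997, §13.2] -/
theorem tAct_weightOp (c r : PowerSeries S) : tAct (weightOp a) (weightOp_adic ha) c r = PowerSeries.C (tEval ha c) * r := by
  symm
  refine eq_tAct_of_forall_sub_mem (weightOp_adic ha) fun K => ?_
  rw [tPartial_weightOp, ← sub_mul, ← map_sub]
  have h := mul_mem_adicFiltGen (C_mem_adicFiltGen (tEval_sub_sum_mem ha c K)) (mem_adicFiltGen_zero (p := p) r)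
  rwa [Nat.add_zero] at h

/-- For a polynomial `c` of degree `< K₀`, `c(a)` is the finite sum `Σ_{k<K₀} c_k a^k`. [cite: Washington1997, §7.1] -/
theorem tEval_eq_sum_of_coeff_eq_zero {c : PowerSeries S} {K₀ : ℕ} (hc : ∀ k, K₀ ≤ k → PowerSeries.coeff k c = 0) :
    tEval ha c = ∑ k ∈ range K₀, PowerSeries.coeff k c * a ^ k := by
  unfold tEval
  rw [tAct_eq_tPartial_of_coeff_eq_zero (weightOp_adic ha) hc, tPartial_weightOp, mul_one, PowerSeries.constantCoeff_C]

/-- `tEval` is additive. [cite: Washington1997, §13.2] -/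
theorem tEval_add (c c' : PowerSeries S) : tEval ha (c + c') = tEval ha c + tEval ha c' := by
  unfold tEval
  rw [tAct_add_left, map_add]

/-- `tEval` is multiplicative. [cite: Washington1997, §13.2] -/
theorem tEval_mul (c c' : PowerSeries S) : tEval ha (c * c') = tEval ha c * tEval ha c' := by
  have h : tAct (weightOp a) (weightOp_adic ha) (c * c') 1 = PowerSeries.C (tEval ha c * tEval ha c') * 1 := by
    rw [tAct_mul, tAct_weightOp ha c', tAct_weightOp ha c, ← mul_assoc, ← map_mul]
  have h2 := congrArg PowerSeries.constantCoeff h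
  rwa [mul_one, PowerSeries.constantCoeff_C] at h2

/-- `tEval 1 = 1`. [cite: Washington1997, §13.2] -/
theorem tEval_one : tEval ha 1 = 1 := by
  unfold tEval
  rw [tAct_one, map_one]

/-- **`tEval (C s) = s`**: constants evaluate to themselves. [cite: Washington1997, §13.2] -/
theorem tEval_C (s : S) : tEval ha (PowerSeries.C s) = s := by
  unfold tEval
  rw [tAct_C, mul_one, PowerSeries.constantCoeff_C]

/-- ★ **`tEval T = a`**. [cite: Washington1997, §13.2] -/
theorem tEval_X : tEval ha PowerSeries.X = a := by
  unfold tEval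
  rw [tAct_X, weightOp_apply, mul_one, PowerSeries.constantCoeff_C]

/-- ★ **`tEval ha : S⟦T⟧ →+* S`** — evaluation at `T = a` is a ring homomorphism. [cite: Washington1997, §7.1, §13.2] -/
def tEvalHom : PowerSeries S →+* S where
  toFun := tEval ha
  map_one' := tEval_one ha
  map_mul' := tEval_mul ha
  map_zero' := by rw [← map_zero PowerSeries.C, tEval_C]
  map_add' := tEval_add ha

/-- Unfolding `tEvalHom`. [cite: Washington1997, §13.2] -/
@[simp] theorem tEvalHom_apply (c : PowerSeries S) : tEvalHom ha c = tEval ha c := rfl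

/-- `tEval (c^n) = c(a)^n`. [cite: Washington1997, §13.2] -/
theorem tEval_pow (c : PowerSeries S) (n : ℕ) : tEval ha (c ^ n) = tEval ha c ^ n :=
  map_pow (tEvalHom ha) c n

/-- `tEval (T − C a) = 0`: the evaluation kills `T − a`. [cite: Washington1997, §13.2] -/
theorem tEval_X_sub_C : tEval ha (PowerSeries.X - PowerSeries.C a) = 0 := by
  rw [← tEvalHom_apply, map_sub, tEvalHom_apply, tEvalHom_apply, tEval_X, tEval_C, sub_self]

/-- **`tEval ((1+T)^n) = (1+a)^n`** — a group element `γ^n ↦ (1+T)^n` evaluates to `κ(γ)^n` when `a = κ(γ) − 1`. [cite: Washington1997, §13.2] -/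
theorem tEval_one_add_X_pow (n : ℕ) : tEval ha ((1 + PowerSeries.X) ^ n) = (1 + a) ^ n := by
  rw [tEval_pow, tEval_add, tEval_one, tEval_X]

/-- A multiple of `T − a` evaluates to `0`. [cite: Washington1997, §13.2] -/
theorem tEval_mul_X_sub_C (c : PowerSeries S) : tEval ha (c * (PowerSeries.X - PowerSeries.C a)) = 0 := by
  rw [tEval_mul, tEval_X_sub_C, mul_zero]

namespace TActModule

/-- ★ **In the weight module `c • r = C(c(a)) * r`** (module form of `tAct_weightOp`). [cite: Washington1997, §13.2] -/
theorem toPS_smul_weight (c : PowerSeries S) (r : TActModule (weightOp a) (weightOp_adic ha)) :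
    toPS (c • r) = PowerSeries.C (tEval ha c) * toPS r := by
  rw [toPS_smul, tAct_weightOp]

/-- `T • r = C a * r` in the weight module. [cite: Washington1997, §13.2] -/
theorem toPS_X_smul_weight (r : TActModule (weightOp a) (weightOp_adic ha)) :
    toPS ((PowerSeries.X : PowerSeries S) • r) = PowerSeries.C a * toPS r := by
  rw [toPS_smul_weight ha, tEval_X]

end TActModule

end Weight

/-! ### §3. Functionals: `λ(D r) = a·λ(r)` makes `λ` the specialisation at `T = a` -/

section Functional

variable [IsAdicComplete (Ideal.span {p}) S] {a : S} (ha : a ∈ Ideal.span {p})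
  {D : PowerSeries S →ₗ[S] PowerSeries S} (hD : ∀ N (r : PowerSeries S), r ∈ adicFiltGen p N → D r ∈ adicFiltGen p (N + 1))
  {φ : PowerSeries S →ₗ[S] S} (hφD : ∀ r, φ (D r) = a * φ r)
  {m : ℕ} (hφ : ∀ N (r : PowerSeries S), r ∈ adicFiltGen p (N + m) → φ r ∈ Ideal.span {p ^ N})

/-- The functional `φ` read as the operator `r ↦ C(φ r)` of `S⟦Y⟧` (constants). [cite: Washington1997, §13.2] -/
def constOp (φ : PowerSeries S →ₗ[S] S) : PowerSeries S →ₗ[S] PowerSeries S where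
  toFun r := PowerSeries.C (φ r)
  map_add' r r' := by rw [map_add, map_add]
  map_smul' s r := by rw [map_smul, smul_eq_mul, map_mul, RingHom.id_apply, PowerSeries.smul_eq_C_mul]

omit [IsAdicComplete (Ideal.span {p}) S] in
/-- Unfolding `constOp`. [cite: Washington1997, §13.2] -/
theorem constOp_apply (φ : PowerSeries S →ₗ[S] S) (r : PowerSeries S) : constOp φ r = PowerSeries.C (φ r) := rfl

omit [IsAdicComplete (Ideal.span {p}) S] in
include hφD in
/-- `φ ∘ D = a·φ` says `constOp φ` intertwines `D` with the weight operator `weightOp a`. [cite: Washington1997, §13.2] -/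
theorem constOp_intertwine (r : PowerSeries S) : constOp φ (D r) = weightOp a (constOp φ r) := by
  rw [constOp_apply, constOp_apply, hφD, map_mul, weightOp_apply]

omit [IsAdicComplete (Ideal.span {p}) S] in
include hφ in
/-- `φ(I_{N+m}) ⊆ (p^N)` says `constOp φ (I_{N+m}) ⊆ I_N`. [cite: Washington1997, §13.2] -/
theorem constOp_adic (N : ℕ) (r : PowerSeries S) (hr : r ∈ adicFiltGen p (N + m)) : constOp φ r ∈ adicFiltGen p N :=
  C_mem_adicFiltGen (hφ N r hr)

include hφD hφ in
/-- ★★ **SPECIALISATION OF FUNCTIONALS**: an `S`-linear `φ : S⟦Y⟧ → S` with `φ(D r) = a·φ(r)` (`a ∈ (p)`) and `φ(I_{N+m}) ⊆ (p^N)` satisfies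
**`φ(c(T)·r) = c(a) · φ(r)` for every `c ∈ S⟦T⟧`** — `φ` is `S⟦T⟧`-linear from `T ↦ D` to `T ↦ a`. [cite: deShalit1987, Ch. I §3.5 (i)–(ii)]
[cite: Washington1997, §13.2] -/
theorem apply_tAct_eq_tEval_mul (c r : PowerSeries S) : φ (tAct D hD c r) = tEval ha c * φ r := by
  have h := tAct_intertwine hD (weightOp_adic ha) (constOp_intertwine hφD) (constOp_adic hφ) c r
  rw [constOp_apply, constOp_apply, tAct_weightOp] at h
  have h2 := congrArg PowerSeries.constantCoeff h
  rw [map_mul, PowerSeries.constantCoeff_C, PowerSeries.constantCoeff_C, PowerSeries.constantCoeff_C] at h2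
  exact h2.symm

include ha hφD hφ in
/-- `φ` kills `(T − a)·r`. [cite: deShalit1987, Ch. I §3.5 (ii)] [cite: Washington1997, §13.2] -/
theorem apply_tAct_X_sub_C (r : PowerSeries S) : φ (tAct D hD (PowerSeries.X - PowerSeries.C a) r) = 0 := by
  rw [apply_tAct_eq_tEval_mul ha hD hφD hφ, tEval_X_sub_C, zero_mul]

namespace TActModule

include hφD hφ in
/-- ★★ **Module form: `φ(c • r) = c(a) · φ(r)`** on `TActModule D hD`. [cite: deShalit1987, Ch. I §3.5 (i)–(ii)] [cite: Washington1997, §13.2] -/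
theorem apply_smul_eq_tEval_mul (c : PowerSeries S) (r : TActModule D hD) : φ (toPS (c • r)) = tEval ha c * φ (toPS r) := by
  rw [toPS_smul, apply_tAct_eq_tEval_mul ha hD hφD hφ]

include ha hφD hφ in
/-- `φ((T − a) • r) = 0`: the kernel of `φ ∘ toPS` contains `(T − a)·TActModule D hD`. [cite: deShalit1987, Ch. I §3.5 (ii)] -/
theorem apply_X_sub_C_smul (r : TActModule D hD) : φ (toPS (((PowerSeries.X : PowerSeries S) - PowerSeries.C a) • r)) = 0 := by
  rw [apply_smul_eq_tEval_mul ha hD hφD hφ, tEval_X_sub_C, zero_mul]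

include ha hφD hφ in
/-- `φ((1+T)^n • r) = (1+a)^n φ(r)`: a group element `γ^n` acts on the values of `φ` through `κ(γ)^n` (`a = κ(γ) − 1`).
[cite: deShalit1987, Ch. I §3.5 (ii)] -/
theorem apply_one_add_X_pow_smul (n : ℕ) (r : TActModule D hD) :
    φ (toPS (((1 + PowerSeries.X) ^ n : PowerSeries S) • r)) = (1 + a) ^ n * φ (toPS r) := by
  rw [apply_smul_eq_tEval_mul ha hD hφD hφ, tEval_one_add_X_pow]

include ha hφD hφ in
/-- The submodule `(T − a)·M` lies in the kernel of `φ ∘ toPS` (`M = TActModule D hD`). [cite: deShalit1987, Ch. I §3.5 (ii)] -/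
theorem apply_eq_zero_of_mem_range_X_sub_C (r : TActModule D hD)
    (hr : r ∈ LinearMap.range (((PowerSeries.X : PowerSeries S) - PowerSeries.C a) • (LinearMap.id : TActModule D hD →ₗ[PowerSeries S] TActModule D hD))) :
    φ (toPS r) = 0 := by
  obtain ⟨s, rfl⟩ := hr
  exact apply_X_sub_C_smul ha hD hφD hφ s

end TActModule

end Functional

section FunctionalMap

variable [IsAdicComplete (Ideal.span {p}) S]
  (D : PowerSeries S →ₗ[S] PowerSeries S) (hD : ∀ N (r : PowerSeries S), r ∈ adicFiltGen p N → D r ∈ adicFiltGen p (N + 1))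
  {a : S} (ha : a ∈ Ideal.span {p})

namespace TActModule

/-- ★ **`TActModule.functionalₗ`**: the functional `φ` as an `S⟦T⟧`-LINEAR map from `TActModule D hD` to the weight module `S⟦Y⟧(a)`
(values in the constants). [cite: deShalit1987, Ch. I §3.5 (ii)] [cite: Washington1997, §13.2] -/
def functionalₗ (φ : PowerSeries S →ₗ[S] S) (hφD : ∀ r, φ (D r) = a * φ r) (m : ℕ)
    (hφ : ∀ N (r : PowerSeries S), r ∈ adicFiltGen p (N + m) → φ r ∈ Ideal.span {p ^ N}) :
    TActModule D hD →ₗ[PowerSeries S] TActModule (weightOp a) (weightOp_adic ha) :=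
  linearOfIntertwine D hD (weightOp a) (weightOp_adic ha) (constOp φ) (constOp_intertwine hφD) m (constOp_adic hφ)

/-- Unfolding `functionalₗ`: `toPS (functionalₗ φ r) = C (φ (toPS r))`. [cite: deShalit1987, Ch. I §3.5 (ii)] -/
@[simp] theorem toPS_functionalₗ_apply (φ : PowerSeries S →ₗ[S] S) (hφD : ∀ r, φ (D r) = a * φ r) (m : ℕ)
    (hφ : ∀ N (r : PowerSeries S), r ∈ adicFiltGen p (N + m) → φ r ∈ Ideal.span {p ^ N}) (r : TActModule D hD) :
    toPS (functionalₗ D hD ha φ hφD m hφ r) = PowerSeries.C (φ (toPS r)) := rfl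

/-- `functionalₗ φ r = 0 ↔ φ (toPS r) = 0`. [cite: deShalit1987, Ch. I §3.5 (ii)] -/
theorem functionalₗ_eq_zero_iff (φ : PowerSeries S →ₗ[S] S) (hφD : ∀ r, φ (D r) = a * φ r) (m : ℕ)
    (hφ : ∀ N (r : PowerSeries S), r ∈ adicFiltGen p (N + m) → φ r ∈ Ideal.span {p ^ N}) (r : TActModule D hD) :
    functionalₗ D hD ha φ hφD m hφ r = 0 ↔ φ (toPS r) = 0 := by
  constructor
  · intro h
    have h2 := congrArg (fun x : TActModule (weightOp a) (weightOp_adic ha) => PowerSeries.constantCoeff (toPS x)) h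
    have h0 : PowerSeries.constantCoeff (toPS (0 : TActModule (weightOp a) (weightOp_adic ha))) = 0 := map_zero _
    simpa only [toPS_functionalₗ_apply, PowerSeries.constantCoeff_C, h0] using h2
  · intro h
    apply toPS_injective
    rw [toPS_functionalₗ_apply, h, map_zero]
    rfl

end TActModule

end FunctionalMap

end LubinTate

end Literature.NumberTheory.GaloisRepresentations
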